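import Summits.RiemannHypothesis.RiemannHypothesis.Theorems.ThetaTier2SinSound
import HarnessLib

/-!
# THETA tier-2 kernel checker — soundness of the HARMONIC LOOP `harm` (E1 cell sums; cc-s2-1, WEIL typing lane; RH-FREE)

(K1), first half (HOME/cc-s2-1/gen22/TIER2-KERNEL-SPEC.md §2/§5): for a base angle `θ` enclosed by `[val lo, val hi]` (in the checker,
`θ = θ₀e^t` on a depth cell) the two accumulators returned by `ThetaTier2Check.harm A lo hi invlo K 0 0` dominate the finite harmonic sums
of THETA-CERT-cc6 E1,

  `Σ_{k=1}^{K} |sin(kθ)|^m / k^{m+1}`  and  `Σ_{k=1}^{K} (c₂|sin kθ|^m + ε|sin kθ|^{m−1}(1 + ι/k)) / k^m`,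

for any reals `c₂ ≤ val A.c2`, `ε ≤ val A.eps`, `0 ≤ ι ≤ val invlo`.  Ingredients: `sinSup_sound` (LEMMA S) for the harmonic
angle `kθ ∈ [val (k·lo), val (k·hi)]`, then `le_powU`, `le_mulU`, `le_divUn` (ThetaTier2Round).  Adding the ζ-residues (`residm1`, `residm`)
is the caller's one-liner (`cellStep`).  Nothing here bears on the truth of RH.
-/

set_option linter.dupNamespace false  -- the mandated namespace repeats `RiemannHypothesis`
set_option autoImplicit false

namespace Summit.RiemannHypothesis.RiemannHypothesis.Theorems.ThetaTier2

open Real Finset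

/-! ## Unfolding the loop (NOTE: use `unfold`/`conv => lhs; unfold`, never the `harm.eq_n` lemmas — generating those for the
compiled tree module makes the kernel recurse through `Nat.brecOn` and fail) -/

/-- `harm` with no fuel returns the accumulators. [this cell] -/
theorem harm_zero (A : Inp) (lo hi invlo sAcc s1Acc : ℕ) : harm A lo hi invlo 0 sAcc s1Acc = (sAcc, s1Acc) := by
  unfold harm; rfl

/-- One step of `harm`: harmonic `k = K − fuel` is added to both accumulators. [this cell] -/
theorem harm_succ (A : Inp) (lo hi invlo fuel sAcc s1Acc : ℕ) :
    harm A lo hi invlo (fuel + 1) sAcc s1Acc =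
      harm A lo hi invlo fuel
        (sAcc + divUn (mulU (powU (sinSup ((A.K - fuel) * lo) ((A.K - fuel) * hi) A.piL A.piH) (A.m - 1))
          (sinSup ((A.K - fuel) * lo) ((A.K - fuel) * hi) A.piL A.piH)) ((A.K - fuel) ^ (A.m + 1)))
        (s1Acc + divUn (mulU A.c2 (mulU (powU (sinSup ((A.K - fuel) * lo) ((A.K - fuel) * hi) A.piL A.piH) (A.m - 1))
          (sinSup ((A.K - fuel) * lo) ((A.K - fuel) * hi) A.piL A.piH)) +
          mulU (mulU A.eps (powU (sinSup ((A.K - fuel) * lo) ((A.K - fuel) * hi) A.piL A.piH) (A.m - 1))) (S + divUn invlo (A.K - fuel)))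
          ((A.K - fuel) ^ A.m)) := by
  conv => lhs; unfold harm

/-- One harmonic: `|sin(kθ)|^m / k^{m+1} ≤ val (divUn (mulU (powU sk (m−1)) sk) (k^(m+1)))` with `sk = sinSup (k·lo) (k·hi) …`,
and the `S₁` analogue. [this cell, TIER2-KERNEL-SPEC §2 (E1)] -/
theorem harmTerm_sound (A : Inp) {lo hi invlo : ℕ} (hπ : val A.piL ≤ π ∧ π ≤ val A.piH)
    (hw : val A.piH - val A.piL ≤ 1 / 2 ^ 30) (hm : 1 ≤ A.m) {k : ℕ} (hk : 1 ≤ k) (hkz : (k : ℝ) * val hi ≤ 2 ^ 24)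
    {θ c₂ ε ι : ℝ} (hθ1 : val lo ≤ θ) (hθ2 : θ ≤ val hi) (hc : c₂ ≤ val A.c2)
    (he : ε ≤ val A.eps) (hι0 : 0 ≤ ι) (hι : ι ≤ val invlo) :
    let sk := sinSup (k * lo) (k * hi) A.piL A.piH
    let skm1 := powU sk (A.m - 1)
    let skm := mulU skm1 sk
    |sin (k * θ)| ^ A.m / (k : ℝ) ^ (A.m + 1) ≤ val (divUn skm (k ^ (A.m + 1))) ∧
      (c₂ * |sin (k * θ)| ^ A.m + ε * |sin (k * θ)| ^ (A.m - 1) * (1 + ι / k)) / (k : ℝ) ^ A.m ≤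
        val (divUn (mulU A.c2 skm + mulU (mulU A.eps skm1) (S + divUn invlo k)) (k ^ A.m)) := by
  intro sk skm1 skm
  have hkpos : (0 : ℝ) < k := by exact_mod_cast hk
  -- LEMMA S on the harmonic angle
  have hsin : |sin (k * θ)| ≤ val sk := by
    apply sinSup_sound hπ hw
    · rw [val_nat_mul]; exact hkz
    · rw [val_nat_mul]; exact mul_le_mul_of_nonneg_left hθ1 hkpos.le
    · rw [val_nat_mul]; exact mul_le_mul_of_nonneg_left hθ2 hkpos.le
  have hs0 : 0 ≤ |sin (k * θ)| := abs_nonneg _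
  have hm1 : |sin (k * θ)| ^ (A.m - 1) ≤ val skm1 := le_powU hs0 hsin _
  have hmm : |sin (k * θ)| ^ A.m ≤ val skm := by
    have : |sin (k * θ)| ^ A.m = |sin (k * θ)| ^ (A.m - 1) * |sin (k * θ)| := by
      rw [← pow_succ]; congr 1; omega
    rw [this]; exact le_mulU hs0 hm1 hsin
  constructor
  · have h := le_divUn hmm (show 0 < k ^ (A.m + 1) from by positivity)
    push_cast at h; exact h
  · have hι' : 1 + ι / k ≤ val (S + divUn invlo k) := by
      rw [val_add, val_S]
      have h := le_divUn hι (show 0 < k from hk)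
      linarith
    have h1 : c₂ * |sin (k * θ)| ^ A.m ≤ val (mulU A.c2 skm) := le_mulU (pow_nonneg hs0 _) hc hmm
    have h2 : ε * |sin (k * θ)| ^ (A.m - 1) ≤ val (mulU A.eps skm1) := le_mulU (pow_nonneg hs0 _) he hm1
    have h3 : ε * |sin (k * θ)| ^ (A.m - 1) * (1 + ι / k) ≤ val (mulU (mulU A.eps skm1) (S + divUn invlo k)) :=
      le_mulU (by positivity) h2 hι'
    have h4 : c₂ * |sin (k * θ)| ^ A.m + ε * |sin (k * θ)| ^ (A.m - 1) * (1 + ι / k) ≤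
        val (mulU A.c2 skm + mulU (mulU A.eps skm1) (S + divUn invlo k)) := by rw [val_add]; linarith
    have h := le_divUn h4 (show 0 < k ^ A.m from by positivity)
    push_cast at h; exact h

/-- **The harmonic loop is sound** (induction on the fuel): the accumulators of `harm A lo hi invlo fuel sAcc s1Acc` dominate
`val sAcc + Σ_{k=K+1−fuel}^{K} |sin kθ|^m k^{−(m+1)}` and the `S₁` analogue. Called with `fuel = K`, `sAcc = s1Acc = 0` this is E1's
finite part on the cell. [this cell, TIER2-KERNEL-SPEC §2 (E1)] -/
theorem harm_sound (A : Inp) {lo hi invlo : ℕ} (hπ : val A.piL ≤ π ∧ π ≤ val A.piH)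
    (hw : val A.piH - val A.piL ≤ 1 / 2 ^ 30) (hm : 1 ≤ A.m) (hsz : (A.K : ℝ) * val hi ≤ 2 ^ 24)
    {θ c₂ ε ι : ℝ} (hθ1 : val lo ≤ θ) (hθ2 : θ ≤ val hi) (hc : c₂ ≤ val A.c2)
    (he : ε ≤ val A.eps) (hι0 : 0 ≤ ι) (hι : ι ≤ val invlo) :
    ∀ fuel : ℕ, fuel ≤ A.K → ∀ sAcc s1Acc : ℕ,
      val sAcc + ∑ k ∈ Ico (A.K + 1 - fuel) (A.K + 1), |sin (k * θ)| ^ A.m / (k : ℝ) ^ (A.m + 1)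
          ≤ val (harm A lo hi invlo fuel sAcc s1Acc).1 ∧
      val s1Acc + ∑ k ∈ Ico (A.K + 1 - fuel) (A.K + 1),
          (c₂ * |sin (k * θ)| ^ A.m + ε * |sin (k * θ)| ^ (A.m - 1) * (1 + ι / k)) / (k : ℝ) ^ A.m
          ≤ val (harm A lo hi invlo fuel sAcc s1Acc).2 := by
  intro fuel
  induction fuel with
  | zero =>
    intro _ sAcc s1Acc
    rw [harm_zero]
    simp
  | succ fuel ih =>
    intro hf sAcc s1Acc
    have hk : 1 ≤ A.K - fuel := by omega
    have hkK : A.K - fuel ≤ A.K := Nat.sub_le _ _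
    have hkz : ((A.K - fuel : ℕ) : ℝ) * val hi ≤ 2 ^ 24 :=
      (mul_le_mul_of_nonneg_right (by exact_mod_cast hkK) (val_nonneg hi)).trans hsz
    obtain ⟨t1, t2⟩ := harmTerm_sound A hπ hw hm hk hkz hθ1 hθ2 hc he hι0 hι
    rw [harm_succ]
    have hbot : A.K + 1 - (fuel + 1) = A.K - fuel := by omega
    have htop : A.K + 1 - fuel = (A.K - fuel) + 1 := by omega
    have hlt : A.K - fuel < A.K + 1 := by omega
    obtain ⟨i1, i2⟩ := ih (by omega)
      (sAcc + divUn (mulU (powU (sinSup ((A.K - fuel) * lo) ((A.K - fuel) * hi) A.piL A.piH) (A.m - 1))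
        (sinSup ((A.K - fuel) * lo) ((A.K - fuel) * hi) A.piL A.piH)) ((A.K - fuel) ^ (A.m + 1)))
      (s1Acc + divUn (mulU A.c2 (mulU (powU (sinSup ((A.K - fuel) * lo) ((A.K - fuel) * hi) A.piL A.piH) (A.m - 1))
        (sinSup ((A.K - fuel) * lo) ((A.K - fuel) * hi) A.piL A.piH)) +
        mulU (mulU A.eps (powU (sinSup ((A.K - fuel) * lo) ((A.K - fuel) * hi) A.piL A.piH) (A.m - 1))) (S + divUn invlo (A.K - fuel)))
        ((A.K - fuel) ^ A.m))
    rw [htop, val_add] at i1 i2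
    rw [hbot, sum_eq_sum_Ico_succ_bot hlt, sum_eq_sum_Ico_succ_bot hlt]
    exact ⟨by linarith, by linarith⟩

end Summit.RiemannHypothesis.RiemannHypothesis.Theorems.ThetaTier2
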